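import Summits.MatrixMultiplication.MatrixMultiplication.Theses.FourierTwoFamiliesModP
import Summits.MatrixMultiplication.MatrixMultiplication.Theorems.FourierTwoFamiliesPrimeCyclicWallRefutation

/-!
# `FourierTwoFamiliesModP.WallBreachModP` (stmt-MatrixMultiplication-14315)

The support item `WallBreachModP` of route `FourierTwoFamiliesModP` says that the "prime-cyclic
wall" is false: for every real `C` there are a prime `p` and a balanced SDPP configuration
(`n` pairs `(A i, B i)` of subsets of `ZMod p`, `|A i| = |B i| = s`, clauses (W) and (X) of
Cohn–Kleinberg–Szegedy–Umans 2005, Def. 4.1) with `C · p < n · s²`.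

This is, word for word after pushing the negation inside, the negation of the retired gen-1 item
`FourierTwoFamilies.PrimeCyclicWall` (stmt-MatrixMultiplication-5964:
`∃ C, ∀ p prime, ∀ balanced SDPP (n, s, A, B) in ZMod p, n · s² ≤ C · p`), which is refuted in the
tree by `FourierTwoFamiliesPrimeCyclicWall_refuted`
(`Theorems/FourierTwoFamiliesPrimeCyclicWallRefutation.lean`): radix-`9` digit designs —
`binom(2l, l)` pairs of size `7^l`, SDPP in `ZMod p` for a Bertrand prime `2·81^l < p ≤ 4·81^l` —
give `n · s² ≥ 98^l > C · p` once `(98/81)^l > 4C`.  So the present file is a one-step transport of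
that theorem; no new construction is needed (the CRT cubes of the route text give the better ratio
`2^l/√(πl)` but are not required for the statement as filed).
-/

-- `Summit.<Summit>.<Problem>` is the tree's mandated summit-side namespace; for this
-- single-conjunct summit the two coincide, so the file silences `dupNamespace`.
set_option linter.dupNamespace false

namespace Summit.MatrixMultiplication.MatrixMultiplication.Theorems

/-- **The prime-cyclic wall is breached** (route `FourierTwoFamiliesModP`, support item
`WallBreachModP`, stmt-MatrixMultiplication-14315): for every `C : ℝ` there are a prime `p` and a
balanced SDPP configuration `(A i, B i)_{i < n}` in `ZMod p`, `|A i| = |B i| = s`, with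
`C · p < n · s²`.  Proof: push the negation through the tree refutation
`FourierTwoFamiliesPrimeCyclicWall_refuted` of `∃ C, ∀ …, n · s² ≤ C · p` (radix-`9` digit designs at
a Bertrand prime). [folklore] -/
theorem wallBreachModP_proof :
    Summit.MatrixMultiplication.MatrixMultiplication.Theses.FourierTwoFamiliesModP.WallBreachModP := by
  unfold Summit.MatrixMultiplication.MatrixMultiplication.Theses.FourierTwoFamiliesModP.WallBreachModP
  have h := FourierTwoFamiliesPrimeCyclicWall_refuted
  unfold Summit.MatrixMultiplication.MatrixMultiplication.Theses.FourierTwoFamilies.PrimeCyclicWall at h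
  push Not at h
  exact h

end Summit.MatrixMultiplication.MatrixMultiplication.Theorems
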